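import Summits.QuantumFields.YangMills.Theorems.UnitScaleTiltProp7SymFrameBound
import HarnessLib

/-!
# Route `UnitScaleTilt`, crux K1 child «MinimiserStabilityRegPr» (stmt-QuantumFields-19200), skeleton v10 stub EX, route (α) — the (AN) supplier of W5 `…CmapTwSymInputs`
# (OWNER RULING g26-№12 (T-sym-frames), ACK «W5 hands with ★w4-20520»): **THE RE-BASED DOUBLE BAR `A ↦ dbarTwS U₀ A c` IS ANALYTIC ON THE FRAME-CHART BALL**

Companion of ✓`Prop7SymFrameBound` (W4).  Two rows:

* §1 `analyticAt_coe_dbarCovIterU_of_plaqSmall` — at a curved plaquette-small SU(2) background (`PlaqSmall a₀ U₀`, any `P`, `k + 1 ≤ m + K`), the covariant double-bar TOWER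
  bond variable `A ↦ U̿^{(k)}(U₀♭, e^{A}U₀♭)(e)` is analytic at every `A₀` of the sup-ball `‖A₀(b)‖ ≤ t ≤ 1` under W2's budgets at `(s₀, δ) = (s_B, 2t)` — the BOND clause of
  W4's generic ✓`analyticAt_coe_dbarCovIterU_frameAccU_of_reads` at the gauged pair in the cluster axial gauge `u = axialT U₀ (embIter k e₋)` of the two blocks of `e`
  (✓`IterPlaqSmallAllL.dist1_axial_cluster_le`), un-gauged by W0 ✓`Prop7SymFrameCovariance.dbarCovIterU_gaugeActT`;
* §2 ★`analyticAt_dbarTwS_of_regPr` — the T³ letter: for `RegPr F n K ε₀ U₀`, `10¹²L³ε₀ ≤ 1`, `10⁹L²e ≤ 1` and `‖A₀(b)‖ ≤ e·η` bondwise, `A ↦ dbarTwS F n K h U₀ A c` is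
  analytic at `A₀` — print's (92) ✓`Prop7SymAvgTwSym.dbarTwS_eq_dbarCovIterU_mul_inv` (`U̿^{twS}(A)(c) = U̿^{(k)}(U₀♭, e^{A}U₀♭)(ĉ)·Ū₀^{(k)}(ĉ)⁻¹`) ∘ §1 ∘ a constant factor.

Cell `ym3-torus`, seat ym-ust-20520-w3 (gen 4); def-free; YM₃ on T³ is rung R3, not the Clay problem; count-neutral toward stmt-QuantumFields-19200.

References: T. Bałaban, CMP **98** (1985) 17–51 [Balaban1985Averaging] ((11)–(12) p.19, (89)–(92) p.31, (127) p.37, Prop. 4 (134)–(135) p.38, (159)–(163) p.42);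
CMP **102** (1985) 277–309 [Balaban1985Variational] ((7) p.278, (44) p.285); CMP **109** (1987) 249–301 [Balaban1987RG1] ((0.4)–(0.11) p.253).
-/

noncomputable section

open Literature.MathematicalPhysics.QuantumFieldTheory.Balaban1983to89
open T4Continuum BlockAveraging
open B5Eq118OneStroke (iterBlockOf)
open NormedSpace
open B15DeterminingSets (embIter)
open B7Prop1Explicit (expUnit val_expUnit)
open B10Eq27TorusAxialLog (gaugeActT gaugeActT_apply axialT unitsField toUField suIncl)
open Summit.QuantumFields.YangMills.Theorems.Prop8Chart (coe_unitsField_toUField emlAvgU emlIterU)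

namespace Summit.QuantumFields.YangMills.Theorems.Prop7SymFrameBound

open Summit.QuantumFields.YangMills.Theorems.Prop7SymAvgTwSym (vframeCovU dbarCovU dbarCovIterU frameAccU)

variable {P : Params}

/-! ## §1 The SU(2) background: the tower bond variable is analytic on the sup-ball -/

section SU2

open scoped Matrix.Norms.L2Operator
open Summit.QuantumFields.YangMills.Theorems.Prop7SymAvgRelativeBound (norm_coe_toUnits_suIncl norm_coe_toUnits_suIncl_inv unitsField_toUField_gaugeActT
  gaugeActT_mul_bg)
open Summit.QuantumFields.YangMills.Theorems.IterPlaqSmallAllL (dist1_axial_cluster_le)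
open Summit.QuantumFields.YangMills.Theorems.Prop7SymFrameCovariance (dbarCovIterU_gaugeActT)

/-- ★★ **THE COVARIANT DOUBLE-BAR TOWER BOND VARIABLE `A ↦ U̿^{(k)}(U₀♭, e^{A}U₀♭)(e)` IS ANALYTIC AT EVERY `A₀` OF THE SUP-BALL `‖A₀(b)‖ ≤ t ≤ 1`, AT A CURVED
PLAQUETTE-SMALL SU(2) BACKGROUND** (`PlaqSmall a₀ U₀`, `k + 1 ≤ m + K`; `s_B := 2d(3Lᵏ − 1)a₀`; the three budgets and the displayed one-step rows exactly as in
✓`analyticAt_coe_frameAccU_of_plaqSmall`).  Cluster axial gauge at the two blocks of `e` (background reads `≤ s_B`), difference reads `≤ 2t`, the bond clause of W4's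
generic row for the gauged family, and the un-gauging `U̿^{(k)}(e) = û^{(k)}(e₋)⁻¹·U̿^{(k),gauged}(e)·û^{(k)}(e₊)` (W0 ✓`dbarCovIterU_gaugeActT`).
[cite: Balaban1985Averaging, (89) p.31, (127) p.37, (159)-(163) p.42, (11)-(12) p.19, Prop. 4 (134)-(135) p.38; Balaban1987RG1, (0.4)-(0.11) p.253] -/
theorem analyticAt_coe_dbarCovIterU_of_plaqSmall {C₁ : ℝ} (hC₁ : 2 ≤ C₁)
    (hstep : ∀ (j : ℕ), j + 1 ≤ P.m + P.K → ∀ (U₀ W : GaugeField P j (Matrix (Fin 2) (Fin 2) ℂ)ˣ) (c : PBond P (j + 1)) (s₀ s₁ δ : ℝ),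
      0 ≤ s₀ → 0 ≤ s₁ → 0 ≤ δ → 120 * (((P.d + 2) * P.L : ℕ) : ℝ) * (s₀ + s₁) ≤ 1 →
      (∀ b : PBond P j, (blockOf b.src = c.src ∨ blockOf b.src = c.tgt) → (blockOf b.tgt = c.src ∨ blockOf b.tgt = c.tgt) →
        ‖((U₀ b : (Matrix (Fin 2) (Fin 2) ℂ)ˣ) : Matrix (Fin 2) (Fin 2) ℂ) - 1‖ ≤ s₀ ∧ ‖((W b : (Matrix (Fin 2) (Fin 2) ℂ)ˣ) : Matrix (Fin 2) (Fin 2) ℂ) - 1‖ ≤ s₁ ∧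
          ‖((W b : (Matrix (Fin 2) (Fin 2) ℂ)ˣ) : Matrix (Fin 2) (Fin 2) ℂ) - ((U₀ b : (Matrix (Fin 2) (Fin 2) ℂ)ˣ) : Matrix (Fin 2) (Fin 2) ℂ)‖ ≤ δ) →
      ‖((dbarCovU U₀ W c : (Matrix (Fin 2) (Fin 2) ℂ)ˣ) : Matrix (Fin 2) (Fin 2) ℂ) * (((emlAvgU U₀ c)⁻¹ : (Matrix (Fin 2) (Fin 2) ℂ)ˣ) : Matrix (Fin 2) (Fin 2) ℂ) - 1‖ ≤
        (P.L : ℝ) * δ + C₁ * (((P.d + 2) * P.L : ℕ) : ℝ) ^ 2 * (s₀ + s₁) ^ 2)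
    (hframe : ∀ (j : ℕ), j + 1 ≤ P.m + P.K → ∀ (U₀ W : GaugeField P j (Matrix (Fin 2) (Fin 2) ℂ)ˣ) (y : Site P (j + 1)) (s₀ s₁ δ : ℝ),
      0 ≤ s₀ → 0 ≤ s₁ → 0 ≤ δ → 120 * (((P.d + 2) * P.L : ℕ) : ℝ) * (s₀ + s₁) ≤ 1 →
      (∀ b : PBond P j, blockOf b.src = y → blockOf b.tgt = y →
        ‖((U₀ b : (Matrix (Fin 2) (Fin 2) ℂ)ˣ) : Matrix (Fin 2) (Fin 2) ℂ) - 1‖ ≤ s₀ ∧ ‖((W b : (Matrix (Fin 2) (Fin 2) ℂ)ˣ) : Matrix (Fin 2) (Fin 2) ℂ) - 1‖ ≤ s₁ ∧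
          ‖((W b : (Matrix (Fin 2) (Fin 2) ℂ)ˣ) : Matrix (Fin 2) (Fin 2) ℂ) - ((U₀ b : (Matrix (Fin 2) (Fin 2) ℂ)ˣ) : Matrix (Fin 2) (Fin 2) ℂ)‖ ≤ δ) →
      ‖((vframeCovU U₀ W y : (Matrix (Fin 2) (Fin 2) ℂ)ˣ) : Matrix (Fin 2) (Fin 2) ℂ) - 1‖ ≤
        (((P.d + 2) * P.L : ℕ) : ℝ) * δ + C₁ * (((P.d + 2) * P.L : ℕ) : ℝ) ^ 2 * (s₀ + s₁) ^ 2)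
    {k : ℕ} (hk : k + 1 ≤ P.m + P.K) (U₀ : GaugeField P 0 (Matrix.specialUnitaryGroup (Fin 2) ℂ)) {a₀ : ℝ} (ha₀ : 0 < a₀) (hU : PlaqSmall a₀ U₀)
    (A₀ : PBond P 0 → Matrix (Fin 2) (Fin 2) ℂ) {t : ℝ} (ht0 : 0 ≤ t) (ht1 : t ≤ 1) (hA : ∀ b, ‖A₀ b‖ ≤ t)
    (hbud₀ : 6400 * (((P.d + 2) * P.L : ℕ) : ℝ) ^ 2 * (P.L : ℝ) ^ k * (2 * ((P.d : ℝ) * (3 * (P.L : ℝ) ^ k - 1)) * a₀) ≤ 1)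
    (hbud : 8 * (16 * C₁ + 2) * (((P.d + 2) * P.L : ℕ) : ℝ) ^ 2 *
      ((P.L : ℝ) ^ k * (2 * t + 30 * (((P.d + 2) * P.L : ℕ) : ℝ) * (2 * ((P.d : ℝ) * (3 * (P.L : ℝ) ^ k - 1)) * a₀))) ≤ 1)
    (hρ : 16 * (((P.d + 2) * P.L : ℕ) : ℝ) *
      (2 * ((P.L : ℝ) ^ k * (2 * t + 30 * (((P.d + 2) * P.L : ℕ) : ℝ) * (2 * ((P.d : ℝ) * (3 * (P.L : ℝ) ^ k - 1)) * a₀))) +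
        30 * (((P.d + 2) * P.L : ℕ) : ℝ) * (P.L : ℝ) ^ k * (2 * ((P.d : ℝ) * (3 * (P.L : ℝ) ^ k - 1)) * a₀)) ≤ 1)
    (e : PBond P k) :
    AnalyticAt ℂ (fun A : PBond P 0 → Matrix (Fin 2) (Fin 2) ℂ =>
      ((dbarCovIterU k (unitsField (toUField U₀)) (fun b => expUnit (A b) * unitsField (toUField U₀) b) e : (Matrix (Fin 2) (Fin 2) ℂ)ˣ) :
        Matrix (Fin 2) (Fin 2) ℂ)) A₀ := by
  set sB : ℝ := 2 * ((P.d : ℝ) * (3 * (P.L : ℝ) ^ k - 1)) * a₀ with hsB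
  set z : Site P k := e.src with hz
  set u : GaugeTransf P 0 (Matrix.specialUnitaryGroup (Fin 2) ℂ) := axialT U₀ (embIter k z) with hu
  set û : GaugeTransf P 0 (Matrix (Fin 2) (Fin 2) ℂ)ˣ := fun x => Unitary.toUnits (suIncl (u x)) with hû
  set V₂ : GaugeField P 0 (Matrix (Fin 2) (Fin 2) ℂ)ˣ := unitsField (toUField U₀) with hV₂
  have hL1 : (1 : ℝ) ≤ P.L := by exact_mod_cast P.L_pos
  have hsB0 : 0 ≤ sB := by
    rw [hsB]
    have h3 : (0 : ℝ) ≤ 3 * (P.L : ℝ) ^ k - 1 := by linarith [one_le_pow₀ (n := k) hL1]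
    positivity
  set Fam : (PBond P 0 → Matrix (Fin 2) (Fin 2) ℂ) → GaugeField P 0 (Matrix (Fin 2) (Fin 2) ℂ)ˣ :=
    fun A => gaugeActT û (fun b => expUnit (A b) * V₂ b) with hFam
  have hF0 : ∀ b : PBond P 0, AnalyticAt ℂ (fun A => ((Fam A b : (Matrix (Fin 2) (Fin 2) ℂ)ˣ) : Matrix (Fin 2) (Fin 2) ℂ)) A₀ :=
    fun b => analyticAt_coe_gaugeActT_expUnit_mul û V₂ b A₀
  -- the two top-level sites of `e`
  set S : Set (Site P k) := {w | w = z ∨ w = z.shift e.dir ∨ w = z.shift e.dir ∨ w = (z.shift e.dir).shift e.dir} with hS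
  have hsrc : e.src ∈ S := Or.inl hz.symm
  have htgt : e.tgt ∈ S := Or.inr (Or.inl rfl)
  -- reads in the cluster axial gauge
  have hreads : ∀ b : PBond P 0, iterBlockOf k b.src ∈ S → iterBlockOf k b.tgt ∈ S →
      ‖((gaugeActT û V₂ b : (Matrix (Fin 2) (Fin 2) ℂ)ˣ) : Matrix (Fin 2) (Fin 2) ℂ) - 1‖ ≤ sB ∧
        ‖((Fam A₀ b : (Matrix (Fin 2) (Fin 2) ℂ)ˣ) : Matrix (Fin 2) (Fin 2) ℂ) - ((gaugeActT û V₂ b : (Matrix (Fin 2) (Fin 2) ℂ)ˣ) : Matrix (Fin 2) (Fin 2) ℂ)‖ ≤ 2 * t := by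
    intro b hbs hbt
    have hB : ‖((gaugeActT û V₂ b : (Matrix (Fin 2) (Fin 2) ℂ)ˣ) : Matrix (Fin 2) (Fin 2) ℂ) - 1‖ ≤ sB := by
      rw [hû, hV₂, ← unitsField_toUField_gaugeActT, coe_unitsField_toUField, ← SU2Mean.dist1_eq_norm, hu]
      exact dist1_axial_cluster_le hk U₀ ha₀ hU z e.dir e.dir b hbs hbt
    refine ⟨hB, ?_⟩
    have hG1 : ‖((gaugeActT û V₂ b : (Matrix (Fin 2) (Fin 2) ℂ)ˣ) : Matrix (Fin 2) (Fin 2) ℂ)‖ ≤ 1 := by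
      rw [gaugeActT_apply, Units.val_mul, Units.val_mul]
      calc _ ≤ ‖((û b.src : (Matrix (Fin 2) (Fin 2) ℂ)ˣ) : Matrix (Fin 2) (Fin 2) ℂ) * ((V₂ b : (Matrix (Fin 2) (Fin 2) ℂ)ˣ) : Matrix (Fin 2) (Fin 2) ℂ)‖ *
            ‖(((û b.tgt)⁻¹ : (Matrix (Fin 2) (Fin 2) ℂ)ˣ) : Matrix (Fin 2) (Fin 2) ℂ)‖ := norm_mul_le _ _
        _ ≤ (‖((û b.src : (Matrix (Fin 2) (Fin 2) ℂ)ˣ) : Matrix (Fin 2) (Fin 2) ℂ)‖ * ‖((V₂ b : (Matrix (Fin 2) (Fin 2) ℂ)ˣ) : Matrix (Fin 2) (Fin 2) ℂ)‖) * 1 := by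
            gcongr
            · exact norm_mul_le _ _
            · exact (norm_coe_toUnits_suIncl_inv (u b.tgt)).le
        _ ≤ (1 * 1) * 1 := by
            gcongr
            · exact (norm_coe_toUnits_suIncl (u b.src)).le
            · rw [hV₂, coe_unitsField_toUField]; exact (Summit.QuantumFields.YangMills.Theorems.Prop8Criticality.norm_coe_su2 (U₀ b)).le
        _ = 1 := by norm_num
    have hE : ‖((expUnit (A₀ b) : (Matrix (Fin 2) (Fin 2) ℂ)ˣ) : Matrix (Fin 2) (Fin 2) ℂ) - 1‖ ≤ 2 * t := by
      rw [val_expUnit]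
      exact (B7TransferAnalyticMean.norm_exp_sub_one_le_two_mul ((hA b).trans ht1)).trans (by linarith [hA b])
    have hval : ((Fam A₀ b : (Matrix (Fin 2) (Fin 2) ℂ)ˣ) : Matrix (Fin 2) (Fin 2) ℂ) - ((gaugeActT û V₂ b : (Matrix (Fin 2) (Fin 2) ℂ)ˣ) : Matrix (Fin 2) (Fin 2) ℂ) =
        (((û b.src : (Matrix (Fin 2) (Fin 2) ℂ)ˣ) : Matrix (Fin 2) (Fin 2) ℂ) * (((expUnit (A₀ b) : (Matrix (Fin 2) (Fin 2) ℂ)ˣ) : Matrix (Fin 2) (Fin 2) ℂ) - 1) *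
          (((û b.src)⁻¹ : (Matrix (Fin 2) (Fin 2) ℂ)ˣ) : Matrix (Fin 2) (Fin 2) ℂ)) * ((gaugeActT û V₂ b : (Matrix (Fin 2) (Fin 2) ℂ)ˣ) : Matrix (Fin 2) (Fin 2) ℂ) := by
      rw [hFam]
      simp only []
      rw [gaugeActT_mul_bg, Units.val_mul, Units.val_mul, Units.val_mul]
      rw [mul_sub, sub_mul, sub_mul, mul_one, Units.mul_inv, one_mul]
    rw [hval]
    calc _ ≤ ‖((û b.src : (Matrix (Fin 2) (Fin 2) ℂ)ˣ) : Matrix (Fin 2) (Fin 2) ℂ) * (((expUnit (A₀ b) : (Matrix (Fin 2) (Fin 2) ℂ)ˣ) : Matrix (Fin 2) (Fin 2) ℂ) - 1) *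
          (((û b.src)⁻¹ : (Matrix (Fin 2) (Fin 2) ℂ)ˣ) : Matrix (Fin 2) (Fin 2) ℂ)‖ * ‖((gaugeActT û V₂ b : (Matrix (Fin 2) (Fin 2) ℂ)ˣ) : Matrix (Fin 2) (Fin 2) ℂ)‖ :=
          norm_mul_le _ _
      _ ≤ (‖((û b.src : (Matrix (Fin 2) (Fin 2) ℂ)ˣ) : Matrix (Fin 2) (Fin 2) ℂ) * (((expUnit (A₀ b) : (Matrix (Fin 2) (Fin 2) ℂ)ˣ) : Matrix (Fin 2) (Fin 2) ℂ) - 1)‖ *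
          ‖(((û b.src)⁻¹ : (Matrix (Fin 2) (Fin 2) ℂ)ˣ) : Matrix (Fin 2) (Fin 2) ℂ)‖) * 1 := by
          gcongr
          exact norm_mul_le _ _
      _ ≤ ((‖((û b.src : (Matrix (Fin 2) (Fin 2) ℂ)ˣ) : Matrix (Fin 2) (Fin 2) ℂ)‖ * ‖((expUnit (A₀ b) : (Matrix (Fin 2) (Fin 2) ℂ)ˣ) : Matrix (Fin 2) (Fin 2) ℂ) - 1‖) * 1) * 1 := by
          gcongr
          · exact norm_mul_le _ _
          · exact (norm_coe_toUnits_suIncl_inv (u b.src)).le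
      _ ≤ ((1 * (2 * t)) * 1) * 1 := by
          gcongr
          exact (norm_coe_toUnits_suIncl (u b.src)).le
      _ = 2 * t := by ring
  -- the bond clause of W4's generic row for the gauged pair
  have h2t : 0 ≤ 2 * t := by positivity
  obtain ⟨hW, -⟩ := analyticAt_coe_dbarCovIterU_frameAccU_of_reads hC₁ hstep hframe Fam A₀ hF0 (gaugeActT û V₂) (Nat.le_of_succ_le hk) hsB0 h2t
    hbud₀ hbud hρ k le_rfl S hreads
  have han := hW e hsrc htgt
  -- un-gauging
  have hfun : (fun A : PBond P 0 → Matrix (Fin 2) (Fin 2) ℂ =>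
      ((dbarCovIterU k V₂ (fun b => expUnit (A b) * V₂ b) e : (Matrix (Fin 2) (Fin 2) ℂ)ˣ) : Matrix (Fin 2) (Fin 2) ℂ)) =
      fun A => (((transfUp û k e.src)⁻¹ : (Matrix (Fin 2) (Fin 2) ℂ)ˣ) : Matrix (Fin 2) (Fin 2) ℂ) *
        ((dbarCovIterU k (gaugeActT û V₂) (Fam A) e : (Matrix (Fin 2) (Fin 2) ℂ)ˣ) : Matrix (Fin 2) (Fin 2) ℂ) *
        ((transfUp û k e.tgt : (Matrix (Fin 2) (Fin 2) ℂ)ˣ) : Matrix (Fin 2) (Fin 2) ℂ) := by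
    funext A
    have key : dbarCovIterU k V₂ (fun b => expUnit (A b) * V₂ b) e =
        (transfUp û k e.src)⁻¹ * dbarCovIterU k (gaugeActT û V₂) (Fam A) e * transfUp û k e.tgt := by
      have h := dbarCovIterU_gaugeActT (transfUp û) (fun _ _ => rfl) V₂ (fun b => expUnit (A b) * V₂ b) k
      rw [show gaugeActT (transfUp û 0) = gaugeActT û from rfl] at h
      rw [hFam]
      simp only []
      rw [h, gaugeActT_apply]; group
    have := congrArg (fun w : (Matrix (Fin 2) (Fin 2) ℂ)ˣ => (w : Matrix (Fin 2) (Fin 2) ℂ)) key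
    simpa only [Units.val_mul] using this
  rw [hfun]
  exact (analyticAt_const.mul han).mul analyticAt_const

end SU2

/-! ## §2 The T³ letter: `A ↦ dbarTwS U₀ A c` is analytic on the frame-chart ball at a printed-regular background -/

section T3

open scoped Matrix.Norms.L2Operator
open T3ContinuumYM3Torus
open T3PrintedRegularMinimiser (RegPr)
open T3LevelShift (siteShift bondShift)
open T3PrintedRegularOrbits (sites_eq)
open T3SectALandauChart (bgUnits eta eta_pos)
open T3RegularMinimiser (regThreshold)
open Summit.QuantumFields.YangMills.Theorems.Prop7SymAvgTwSym (dbarTwS dbarTwS_eq_dbarCovIterU_mul_inv)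

variable (F : T3Family) {n K : ℕ} (h : n ≤ K)

/-- ★★ **THE (AN) SUPPLIER OF W5 — `A ↦ dbarTwS U₀ A c` IS ANALYTIC AT EVERY `A₀` WITH `‖A₀(b)‖ ≤ e·η`, AT A PRINTED-REGULAR BACKGROUND** (`RegPr F n K ε₀ U₀`, k-uniform
windows `10¹²L³ε₀ ≤ 1`, `10⁹L²e ≤ 1`): print's (92) `U̿^{twS}(A)(c) = U̿^{(k)}(U₀♭, e^{A}U₀♭)(ĉ)·Ū₀^{(k)}(ĉ)⁻¹` (✓`dbarTwS_eq_dbarCovIterU_mul_inv`), §1 at the route's letters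
(`d = 3`, `ℓ = 5L`, `a₀ = ε₀L^{−2(K−n)}`, `Lᵏs_B ≤ 18ε₀`, `Lᵏt = e`, W1's rows at `C₁ = 22100` — the budgets exactly as in ✓`analyticAt_frameTwS_of_regPr`), constant right factor.
[cite: Balaban1985Averaging, (92) p.31, (127) p.37, (159)-(163) p.42; Balaban1985Variational, (7) p.278, (44) p.285] -/
theorem analyticAt_dbarTwS_of_regPr {ε₀ e : ℝ} (hε₀ : 0 < ε₀) (he : 0 ≤ e) (hε : 10 ^ 12 * (F.L : ℝ) ^ 3 * ε₀ ≤ 1) (he9 : 10 ^ 9 * (F.L : ℝ) ^ 2 * e ≤ 1)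
    (U₀ : GaugeField (F.P K) 0 (Matrix.specialUnitaryGroup (Fin 2) ℂ)) (hreg : RegPr F n K ε₀ U₀) (c : PBond (F.P n) 0)
    {A₀ : PBond (F.P K) 0 → Matrix (Fin 2) (Fin 2) ℂ} (hA₀ : ∀ b, ‖A₀ b‖ ≤ e * eta F n K) :
    AnalyticAt ℂ (fun A : PBond (F.P K) 0 → Matrix (Fin 2) (Fin 2) ℂ => ((dbarTwS F n K h U₀ A c : (Matrix (Fin 2) (Fin 2) ℂ)ˣ) : Matrix (Fin 2) (Fin 2) ℂ)) A₀ := by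
  -- letters (as in `analyticAt_frameTwS_of_regPr`)
  have hd : (F.P K).d = 3 := T3Family.P_d F K
  have hLn : (F.P K).L = F.L := rfl
  have hL3 : 3 ≤ F.L := by obtain ⟨a, ha⟩ := F.hL.1; have := F.hL.2; omega
  have hL3r : (3 : ℝ) ≤ F.L := by exact_mod_cast hL3
  have hL0 : (0 : ℝ) < F.L := by linarith
  have hL1 : (1 : ℝ) ≤ F.L := by linarith
  have hk1 : K - n + 1 ≤ (F.P K).m + (F.P K).K := by
    show K - n + 1 ≤ F.m + K; have := F.hm; omega
  set X : ℝ := (F.L : ℝ) ^ (K - n) with hX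
  have hX1 : 1 ≤ X := one_le_pow₀ hL1
  have hX0 : 0 < X := by positivity
  have hXη : X * eta F n K = 1 := by
    show (F.L : ℝ) ^ (K - n) * ((F.L : ℝ)⁻¹) ^ (K - n) = 1
    rw [inv_pow, mul_inv_cancel₀ (pow_ne_zero _ hL0.ne')]
  have hη0 : 0 < eta F n K := eta_pos F n K
  set a₀ : ℝ := regThreshold F n K ε₀ with ha₀
  have ha₀0 : 0 < a₀ := by rw [ha₀]; unfold regThreshold; positivity
  have hXa : X * (X * a₀) = ε₀ := by
    have hX2 : X * X = (F.L : ℝ) ^ (2 * (K - n)) := by rw [hX, ← pow_add, two_mul]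
    have ha : a₀ = ε₀ * ((F.L : ℝ) ^ (2 * (K - n)))⁻¹ := by rw [ha₀]; unfold regThreshold; rw [inv_pow]
    rw [← mul_assoc, hX2, ha, mul_comm ε₀, ← mul_assoc, mul_inv_cancel₀ (pow_ne_zero _ hL0.ne'), one_mul]
  have hU : PlaqSmall a₀ U₀ := hreg.1
  set t : ℝ := e * eta F n K with ht
  have ht0 : 0 ≤ t := by positivity
  have hXt : X * t = e := by rw [ht, mul_left_comm, hXη, mul_one]
  have he1 : e ≤ 1 := by nlinarith [mul_nonneg (by norm_num : (0 : ℝ) ≤ 10 ^ 9) (mul_nonneg (sq_nonneg (F.L : ℝ)) he)]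
  have ht1 : t ≤ 1 := by
    have hη1 : eta F n K ≤ 1 := by
      have : eta F n K = X⁻¹ := eq_inv_of_mul_eq_one_right hXη
      rw [this]; exact inv_le_one_of_one_le₀ hX1
    calc t = e * eta F n K := rfl
      _ ≤ 1 * 1 := mul_le_mul he1 hη1 hη0.le zero_le_one
      _ = 1 := one_mul 1
  set sB : ℝ := 2 * (((3 : ℕ) : ℝ) * (3 * X - 1)) * a₀ with hsB
  have hsB0 : 0 ≤ sB := by
    rw [hsB]; have : (0 : ℝ) ≤ 3 * X - 1 := by linarith
    positivity
  have hXsB : X * sB ≤ 18 * ε₀ := by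
    rw [hsB, ← hXa]; push_cast; nlinarith [mul_nonneg hX0.le ha₀0.le]
  have hXsB0 : 0 ≤ X * sB := mul_nonneg hX0.le hsB0
  have hℓ : ((((3 : ℕ) + 2) * F.L : ℕ) : ℝ) = 5 * F.L := by push_cast; ring
  have hε' : (F.L : ℝ) ^ 3 * ε₀ ≤ 1 / 10 ^ 12 := by
    rw [le_div_iff₀ (by positivity)]; linarith
  have he' : (F.L : ℝ) ^ 2 * e ≤ 1 / 10 ^ 9 := by
    rw [le_div_iff₀ (by positivity)]; linarith
  have hL23 : (F.L : ℝ) ^ 2 ≤ (F.L : ℝ) ^ 3 := pow_le_pow_right₀ hL1 (by norm_num)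
  have hL12 : (F.L : ℝ) ≤ (F.L : ℝ) ^ 2 := by nlinarith
  have hL2ε : (F.L : ℝ) ^ 2 * ε₀ ≤ (F.L : ℝ) ^ 3 * ε₀ := mul_le_mul_of_nonneg_right hL23 hε₀.le
  have hLe : (F.L : ℝ) * e ≤ (F.L : ℝ) ^ 2 * e := mul_le_mul_of_nonneg_right hL12 he
  have hbud₀ : 6400 * ((((3 : ℕ) + 2) * F.L : ℕ) : ℝ) ^ 2 * X * sB ≤ 1 := by
    rw [hℓ]
    have : 6400 * (5 * (F.L : ℝ)) ^ 2 * X * sB = 160000 * (F.L : ℝ) ^ 2 * (X * sB) := by ring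
    rw [this]; nlinarith [sq_nonneg (F.L : ℝ)]
  have hbud : 8 * (16 * (22100 : ℝ) + 2) * ((((3 : ℕ) + 2) * F.L : ℕ) : ℝ) ^ 2 * (X * (2 * t + 30 * ((((3 : ℕ) + 2) * F.L : ℕ) : ℝ) * sB)) ≤ 1 := by
    rw [hℓ]
    have : 8 * (16 * (22100 : ℝ) + 2) * (5 * (F.L : ℝ)) ^ 2 * (X * (2 * t + 30 * (5 * (F.L : ℝ)) * sB)) =
        141440800 * (F.L : ℝ) ^ 2 * (X * t) + 10608060000 * (F.L : ℝ) ^ 3 * (X * sB) := by ring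
    rw [this, hXt]; nlinarith [pow_nonneg hL0.le 3]
  have hρ : 16 * ((((3 : ℕ) + 2) * F.L : ℕ) : ℝ) *
      (2 * (X * (2 * t + 30 * ((((3 : ℕ) + 2) * F.L : ℕ) : ℝ) * sB)) + 30 * ((((3 : ℕ) + 2) * F.L : ℕ) : ℝ) * X * sB) ≤ 1 := by
    rw [hℓ]
    have : 16 * (5 * (F.L : ℝ)) * (2 * (X * (2 * t + 30 * (5 * (F.L : ℝ)) * sB)) + 30 * (5 * (F.L : ℝ)) * X * sB) =
        320 * (F.L : ℝ) * (X * t) + 36000 * (F.L : ℝ) ^ 2 * (X * sB) := by ring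
    rw [this, hXt]; nlinarith [sq_nonneg (F.L : ℝ)]
  -- §1 at the top bond `ĉ`
  have h1 := analyticAt_coe_dbarCovIterU_of_plaqSmall (P := F.P K) (C₁ := 22100) (by norm_num) hstep_of_W1 hframe_of_W1 hk1 U₀ ha₀0 hU A₀ ht0 ht1 hA₀
    (by rw [hd, hLn, ← hX, ← hsB]; exact hbud₀) (by rw [hd, hLn, ← hX, ← hsB]; exact hbud) (by rw [hd, hLn, ← hX, ← hsB]; exact hρ)
    (bondShift (sites_eq F n K h) c)
  -- (92) and the constant right factor
  have hfun : (fun A : PBond (F.P K) 0 → Matrix (Fin 2) (Fin 2) ℂ => ((dbarTwS F n K h U₀ A c : (Matrix (Fin 2) (Fin 2) ℂ)ˣ) : Matrix (Fin 2) (Fin 2) ℂ)) =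
      fun A => ((dbarCovIterU (K - n) (unitsField (toUField U₀)) (fun b => expUnit (A b) * unitsField (toUField U₀) b) (bondShift (sites_eq F n K h) c) :
          (Matrix (Fin 2) (Fin 2) ℂ)ˣ) : Matrix (Fin 2) (Fin 2) ℂ) *
        (((emlIterU (K - n) (unitsField (toUField U₀)) (bondShift (sites_eq F n K h) c))⁻¹ : (Matrix (Fin 2) (Fin 2) ℂ)ˣ) : Matrix (Fin 2) (Fin 2) ℂ) := by
    funext A
    rw [dbarTwS_eq_dbarCovIterU_mul_inv, Units.val_mul, bgUnits_eq_unitsField]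
  rw [hfun]
  exact h1.mul analyticAt_const

end T3

end Summit.QuantumFields.YangMills.Theorems.Prop7SymFrameBound

end
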